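import Literature.NumberTheory.Transcendental.ZeroEstOperators
import Literature.NumberTheory.Transcendental.ZeroEstSubgroups
import Literature.NumberTheory.Transcendental.ZeroEstDimension
import Literature.NumberTheory.Transcendental.PhilipponZeroEstimateP1nDescent
import HarnessLib

/-!
# Zero estimates on commutative algebraic groups, XV: the descent of Roy's proof of Thm. 4.1

Topic `Literature/NumberTheory/Transcendental`. Fifteenth module of the discharge of
`Literature.NumberTheory.Transcendental.philippon1986_std` through D. Roy's exposition of
Philippon's zero estimate (Nesterenko–Philippon (eds.), LNM 1752, Ch. 11, proof of Thm. 4.1,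
pp. 218–220, steps (a)–(e)) for an abstract analytic group model `M : AnalyticGroupModel V N` —
the tree's `PhilipponZeroEstimateMain.lean` (`GaGm.exists_descent_data`) transplanted to the
additive group `V` with the ideals `∂^T_Γ(P)` of `ZeroEstOperators.lean` and the subgroup theory
of `ZeroEstSubgroups.lean`.

With `I_k = ∂^{kT}_{Σ(k)}(P)` (`royI`, indexed from `0`) and `X_k = Z_G(I_k)` (`royX`): the `X_k`
decrease, contain `0` for `k ≤ n` (the vanishing of `P` to order `> nT` on `Σ(n)`), `X_0 ≠ V`
(`P ∉ 𝔊`); two consecutive dimensions agree (pigeonhole); a top component `V₁` of `X_{r+1}` has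
`σ + V₁ ⊆ X_r` for `σ ∈ Σ`; `𝔄 = ∂^{rT}_{V₁ + Σ(r)}(P)` cuts out the transporter
`E = {a ; a + V₁ ⊆ X_r}`; the stabiliser `St` of `V₁` is a closed subgroup with identity component
`H₀`; `Σ ⊆ E`, `E + St ⊆ E`, the cosets `σ + H₀` lie in `E` and have the dimension of `E`, and
every member of `𝔄` vanishes to order `> T` along `W` at the points of `Σ + St` (Roy's (d), via
`VanishesToOrder.of_mem_dIdeal`). PROVED here: `exists_descent_data`.

## References

* Yu. V. Nesterenko, P. Philippon (eds.), *Introduction to Algebraic Independence Theory*,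
  LNM 1752, Springer 2001, Ch. 11 (D. Roy), Thm. 4.1 and its proof (pp. 218–220). [NesterenkoPhilippon2001]
* P. Philippon, *Lemmes de zéros dans les groupes algébriques commutatifs*, Bull. Soc. Math.
  France 114 (1986), 355–383, Thm. 2.1, §5. [Philippon1986]
-/

noncomputable section

open MvPolynomial Set Module
open scoped Pointwise

namespace Literature.NumberTheory.Transcendental

namespace AnalyticGroupModel

variable {V : Type*} [NormedAddCommGroup V] [NormedSpace ℂ V] {N : ℕ} (M : AnalyticGroupModel V N)

attribute [local instance] MvPolynomial.gradedAlgebra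

section Descent

variable (W : Submodule ℂ V) (S : Set V) (T : ℕ) (P : MvPolynomial (Fin (N + 1)) ℂ)

/-- Roy's ideals `I_{k+1} = ∂^{kT}_{Σ(k)}(P)` (indexed from `0`). [cite: NesterenkoPhilippon2001, Ch. 11 Thm. 4.1 (proof)] -/
def royI (k : ℕ) : Ideal (MvPolynomial (Fin (N + 1)) ℂ) := M.dIdeal W P (sumset S k) (k * T)

/-- Roy's closed sets `X_{k+1} = Z_G(I_{k+1})` (indexed from `0`). [cite: NesterenkoPhilippon2001, Ch. 11 Thm. 4.1 (proof)] -/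
def royX (k : ℕ) : Set V := M.zeroSet (M.royI W S T P k : Set (MvPolynomial (Fin (N + 1)) ℂ))

variable {W S T P}

/-- `X_k = {a ; F_P` vanishes to order `> kT` along `W` at `a + Σ(k)}`. [cite: NesterenkoPhilippon2001, Ch. 11 Prop. 3.6 (iii)] -/
theorem mem_royX_iff {D : ℕ} (hP : P.IsHomogeneous D) {k : ℕ} {a : V} :
    a ∈ M.royX W S T P k ↔ ∀ γ ∈ sumset S k, VanishesToOrder W (M.F P) (a + γ) (k * T + 1) := by
  rw [royX, royI, M.zeroSet_dIdeal hP]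
  rfl

/-- The `X_k` are closed. [folklore] -/
theorem isClosedG_royX (k : ℕ) : M.IsClosedG (M.royX W S T P k) := M.isClosedG_zeroSet _

/-- The `X_k` decrease. [folklore] -/
theorem royX_antitone {D : ℕ} (hP : P.IsHomogeneous D) (h0 : (0 : V) ∈ S) {k k' : ℕ} (h : k ≤ k') :
    M.royX W S T P k' ⊆ M.royX W S T P k := by
  rw [royX, royX, royI, royI]
  exact M.zeroSet_dIdeal_antitone hP (sumset_mono h0 h) (Nat.mul_le_mul_right T h)

/-- `0 ∈ X_k` for `k ≤ n` from the vanishing of `P` to order `> nT` on `Σ(n)`. [cite: NesterenkoPhilippon2001, Ch. 11 Thm. 4.1 (proof)] -/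
theorem zero_mem_royX {D : ℕ} (hP : P.IsHomogeneous D) (h0 : (0 : V) ∈ S) {n : ℕ}
    (hvan : ∀ σ ∈ sumset S n, VanishesToOrder W (M.F P) σ (n * T + 1)) {k : ℕ} (hk : k ≤ n) :
    (0 : V) ∈ M.royX W S T P k := by
  rw [M.mem_royX_iff hP]
  intro γ hγ
  rw [zero_add]
  exact (hvan γ (sumset_mono h0 hk hγ)).mono (by nlinarith)

/-- `X_0 = Z(P) ≠ V` when `F_P ≢ 0`. [folklore] -/
theorem royX_zero_ne_univ {D : ℕ} (hP : P.IsHomogeneous D) (hP0 : ∃ w, M.F P w ≠ 0) :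
    M.royX W S T P 0 ≠ univ := by
  obtain ⟨w, hw⟩ := hP0
  intro h
  have hw' : w ∈ M.royX W S T P 0 := h ▸ mem_univ w
  rw [M.mem_royX_iff hP] at hw'
  have := hw' 0 (by rw [sumset_zero]; rfl)
  rw [add_zero, zero_mul, zero_add, vanishesToOrder_one_iff] at this
  exact hw this

/-- `σ + X_{k+1} ⊆ X_k` for `σ ∈ Σ`. [cite: NesterenkoPhilippon2001, Ch. 11 Thm. 4.1 (proof)] -/
theorem vadd_mem_royX {D : ℕ} (hP : P.IsHomogeneous D) {σ v : V} (hσ : σ ∈ S) {k : ℕ}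
    (hv : v ∈ M.royX W S T P (k + 1)) : σ + v ∈ M.royX W S T P k := by
  rw [M.mem_royX_iff hP] at hv ⊢
  intro γ hγ
  have hmem : σ + γ ∈ sumset S (k + 1) := by
    have := add_mem_sumset_succ hγ hσ
    rwa [add_comm γ σ] at this
  have := hv (σ + γ) hmem
  rw [show v + (σ + γ) = σ + v + γ by abel] at this
  exact this.mono (by nlinarith)

end Descent

/-! ### The descent data -/

/-- **The descent of Roy's proof of Thm. 4.1, packaged.** From a form `P` of degree `D` with
`F_P ≢ 0` vanishing to order `> nT` along `W` at the points of `Σ(n)` (`0 ∈ Σ` finite) we obtain: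
a closed subgroup `St` with identity component `H₀` (closed irreducible subgroup), a special
homogeneous ideal `𝔄 ⊇ 𝔊` generated modulo `𝔊` by forms of degree `c·D` (the set `derivGens`),
with zero set `E`, such that `Σ ⊆ E`, the cosets `σ + H₀` (`σ ∈ Σ`) lie in `E` and have the
dimension of `E`, every member of `𝔄` vanishes to order `> T` along `W` at every point of
`Σ + St`, `dim E ≤ n`, and a point `v₀` with `F_P(v₀ + h) = 0` for `h ∈ H₀`.
[cite: NesterenkoPhilippon2001, Ch. 11 Thm. 4.1 (proof, steps a–e)] -/
theorem exists_descent_data [CompleteSpace V] [FiniteDimensional ℂ V] (W : Submodule ℂ V) {S : Set V} (h0 : (0 : V) ∈ S) (T : ℕ)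
    {P : MvPolynomial (Fin (N + 1)) ℂ} {D : ℕ} (hP : P.IsHomogeneous D) (hP0 : ∃ w, M.F P w ≠ 0)
    (hvan : ∀ σ ∈ sumset S M.dim, VanishesToOrder W (M.F P) σ (M.dim * T + 1)) :
    ∃ (St : AddSubgroup V) (hSt : M.IsClosedG (St : Set V)) (Γ : Set V) (k : ℕ) (v₀ : V),
      let H₀ : AddSubgroup V := M.idComp St hSt
      let 𝔄 := M.dIdeal W P Γ (k * T)
      let E := M.zeroSet (𝔄 : Set (MvPolynomial (Fin (N + 1)) ℂ))
      (∀ h ∈ H₀, M.F P (v₀ + h) = 0) ∧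
      S ⊆ E ∧ H₀ ≤ St ∧
      (∀ σ ∈ S, σ +ᵥ ((H₀ : AddSubgroup V) : Set V) ⊆ E) ∧
      (∀ σ ∈ S, M.coneDim (σ +ᵥ ((H₀ : AddSubgroup V) : Set V)) = M.coneDim E) ∧
      (∀ σ ∈ S, ∀ s ∈ St, ∀ Q ∈ 𝔄, VanishesToOrder W (M.F Q) (σ + s) (T + 1)) ∧
      M.coneDim E ≤ M.dim ∧ M.coneDim E = M.coneDim ((H₀ : AddSubgroup V) : Set V) := by
  classical
  have hc : 1 ≤ M.lawDeg := M.lawDeg_pos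
  set n := M.dim with hn
  -- the chain `X_k`
  have hXcl : ∀ k, M.IsClosedG (M.royX W S T P k) := fun k => M.isClosedG_royX k
  have h0X : ∀ k, k ≤ n → (0 : V) ∈ M.royX W S T P k := fun k hk => M.zero_mem_royX hP h0 hvan hk
  have hXne : ∀ k, k ≤ n → (M.royX W S T P k).Nonempty := fun k hk => ⟨0, h0X k hk⟩
  -- `dim X_0 ≤ n`
  have hd0 : M.coneDim (M.royX W S T P 0) ≤ n := by
    have hlt := M.coneDim_lt_of_ssubset M.isIrred_univ (hXcl 0) (hXne 0 (Nat.zero_le _))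
      (ssubset_univ_iff.mpr (M.royX_zero_ne_univ hP hP0))
    rw [M.coneDim_univ] at hlt
    omega
  -- pigeonhole on `k ↦ dim X_k`
  obtain ⟨r, hrn, hdr⟩ := GaGm.Descent.exists_eq_succ_of_antitone (d := fun k => M.coneDim (M.royX W S T P k))
    (fun k => M.coneDim_mono (M.royX_antitone hP h0 (Nat.le_succ k))) hd0
  -- `X_{r+1}` is non-empty: `dim X_{r+1} = dim X_r ≥ 1`
  have hXr : (M.royX W S T P r).Nonempty := hXne r hrn
  have hXr1 : (M.royX W S T P (r + 1)).Nonempty := by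
    by_contra hemp
    rw [not_nonempty_iff_eq_empty] at hemp
    have h1 := M.one_le_coneDim hXr
    rw [hdr, hemp, coneDim_empty] at h1
    exact absurd h1 (by norm_num)
  -- a top-dimensional component `V₁` of `X_{r+1}`
  obtain ⟨𝔮ᵥ, h𝔮ᵥ, hdimV⟩ := M.exists_minimalPrimes_coneDim_eq hXr1
  obtain ⟨hV, -, hVsub⟩ := M.isIrred_zeroSet_of_mem_minimalPrimes h𝔮ᵥ
  rw [(hXcl (r + 1)).eq] at hVsub
  generalize hVgen : M.zeroSet ((𝔮ᵥ : Ideal _) : Set (MvPolynomial (Fin (N + 1)) ℂ)) = V₁ at hV hVsub hdimV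
  -- the stabiliser and its identity component
  have hStcl : M.IsClosedG ((stab V₁ : AddSubgroup V) : Set V) := M.isClosedG_stab hc hV
  set St : AddSubgroup V := stab V₁ with hSt
  set H₀ : AddSubgroup V := M.idComp St hStcl with hH₀
  have hH₀St : H₀ ≤ St := M.idComp_le St hStcl
  have hH₀irr : M.IsIrred ((H₀ : AddSubgroup V) : Set V) := M.isIrred_idComp St hStcl
  obtain ⟨Tf, -, hStT⟩ := M.exists_finset_eq_biUnion_vadd_idComp St hStcl
  -- `𝔄 = ∂^{rT}_{V₁ + Σ(r)}(P)`, `E = Z(𝔄)` the transporter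
  set Γ : Set V := V₁ + sumset S r with hΓ
  set 𝔄 := M.dIdeal W P Γ (r * T) with h𝔄
  set E := M.zeroSet (𝔄 : Set (MvPolynomial (Fin (N + 1)) ℂ)) with hE
  have hmemE : ∀ a, a ∈ E ↔ a +ᵥ V₁ ⊆ M.royX W S T P r := by
    intro a
    rw [hE, h𝔄, M.zeroSet_dIdeal hP]
    simp only [mem_setOf_eq]
    constructor
    · rintro h _ ⟨v, hv, rfl⟩
      rw [M.mem_royX_iff hP]
      intro γ hγ
      have := h (v + γ) ⟨v, hv, γ, hγ, rfl⟩
      simpa only [vadd_eq_add, add_assoc] using this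
    · intro h γ hγ
      obtain ⟨v, hv, τ, hτ, rfl⟩ := hγ
      have hav : a + v ∈ M.royX W S T P r := h ⟨v, hv, rfl⟩
      rw [M.mem_royX_iff hP] at hav
      have := hav τ hτ
      rwa [← add_assoc]
  have hEcl : M.IsClosedG E := M.isClosedG_zeroSet _
  have hSE : S ⊆ E := fun σ hσ => (hmemE σ).mpr (by
    rintro _ ⟨v, hv, rfl⟩
    exact M.vadd_mem_royX hP hσ (hVsub hv))
  have h0E : (0 : V) ∈ E := hSE h0
  have hESt : ∀ g ∈ E, ∀ s ∈ St, g + s ∈ E := fun g hg s hs => by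
    rw [hmemE, ← vadd_vadd, (mem_stab_iff).mp hs]
    exact (hmemE g).mp hg
  have hcosE : ∀ g ∈ E, g +ᵥ ((H₀ : AddSubgroup V) : Set V) ⊆ E := by
    rintro g hg _ ⟨h, hh, rfl⟩
    exact hESt g hg h (hH₀St hh)
  -- `E`-translates of `V₁` are top-dimensional components of `X_r`
  have htrans : ∀ a ∈ E, ∃ 𝔮 ∈ (M.vanishing (M.royX W S T P r)).minimalPrimes,
      a +ᵥ V₁ = M.zeroSet ((𝔮 : Ideal _) : Set (MvPolynomial (Fin (N + 1)) ℂ)) := fun a ha => by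
    obtain ⟨𝔮, h𝔮, he, -⟩ := (hV.vadd M a).exists_eq_zeroSet_minimalPrimes M (hXcl r) ((hmemE a).mp ha)
      (by rw [M.coneDim_vadd hc hV.isClosedG, hdimV]; exact hdr.symm)
    exact ⟨𝔮, h𝔮, he⟩
  -- finitely many `St`-cosets cover `E`
  have hcover : ∃ C : Finset V, E ⊆ ⋃ a ∈ C, a +ᵥ ((St : AddSubgroup V) : Set V) := by
    have hpick : ∀ 𝔮 : Ideal (MvPolynomial (Fin (N + 1)) ℂ), ∃ a : V,
        (∃ a' ∈ E, a' +ᵥ V₁ = M.zeroSet ((𝔮 : Ideal _) : Set (MvPolynomial (Fin (N + 1)) ℂ))) →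
          a +ᵥ V₁ = M.zeroSet ((𝔮 : Ideal _) : Set (MvPolynomial (Fin (N + 1)) ℂ)) := by
      intro 𝔮
      by_cases h : ∃ a' ∈ E, a' +ᵥ V₁ = M.zeroSet ((𝔮 : Ideal _) : Set (MvPolynomial (Fin (N + 1)) ℂ))
      · obtain ⟨a', -, h'⟩ := h; exact ⟨a', fun _ => h'⟩
      · exact ⟨0, fun h' => absurd h' h⟩
    choose pick hpick using hpick
    refine ⟨(M.comps (M.royX W S T P r)).image pick, fun a ha => ?_⟩
    obtain ⟨𝔮, h𝔮, ha𝔮⟩ := htrans a ha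
    have hp := hpick 𝔮 ⟨a, ha, ha𝔮⟩
    rw [mem_iUnion₂]
    refine ⟨pick 𝔮, Finset.mem_image_of_mem _ ((M.mem_comps).mpr h𝔮), -(pick 𝔮) + a, ?_, ?_⟩
    · show -(pick 𝔮) + a ∈ St
      rw [hSt, mem_stab_iff, ← vadd_vadd, ha𝔮, ← hp, neg_vadd_vadd]
    · show pick 𝔮 +ᵥ (-(pick 𝔮) + a) = a
      rw [vadd_eq_add]; abel
  obtain ⟨C, hEC⟩ := hcover
  -- `dim E ≤ dim H₀`
  have hdimE : M.coneDim E ≤ M.coneDim ((H₀ : AddSubgroup V) : Set V) := by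
    obtain ⟨𝔯, h𝔯, hdim𝔯⟩ := M.exists_minimalPrimes_coneDim_eq (X := E) ⟨0, h0E⟩
    obtain ⟨h𝔯irr, -, h𝔯sub⟩ := M.isIrred_zeroSet_of_mem_minimalPrimes h𝔯
    rw [hEcl.eq] at h𝔯sub
    have hsub : M.zeroSet ((𝔯 : Ideal _) : Set (MvPolynomial (Fin (N + 1)) ℂ)) ⊆
        ⋃ p ∈ C ×ˢ Tf, (p.1 + p.2) +ᵥ ((H₀ : AddSubgroup V) : Set V) := by
      intro g hg
      obtain ⟨a, ha, hga⟩ := mem_iUnion₂.mp (hEC (h𝔯sub hg))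
      obtain ⟨s, hs, rfl⟩ := hga
      have hsSt : s ∈ ((St : AddSubgroup V) : Set V) := hs
      rw [hStT] at hsSt
      obtain ⟨b, hb, hsb⟩ := mem_iUnion₂.mp hsSt
      obtain ⟨g', hg', rfl⟩ := hsb
      rw [mem_iUnion₂]
      exact ⟨(a, b), Finset.mem_product.mpr ⟨ha, hb⟩, g', hg', by simp [vadd_eq_add, add_assoc]⟩
    obtain ⟨p, -, hp⟩ := h𝔯irr.exists_subset_of_subset_biUnion M (C ×ˢ Tf) _
      (fun p _ => (hH₀irr.isClosedG).vadd M _) hsub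
    rw [← hdim𝔯]
    exact (M.coneDim_mono hp).trans (M.coneDim_vadd hc hH₀irr.isClosedG _).le
  -- Roy's (d): members of `𝔄` vanish to order `> T` at the points of `Σ + St`
  have hdT : ∀ σ ∈ S, ∀ s ∈ St, ∀ Q ∈ 𝔄, VanishesToOrder W (M.F Q) (σ + s) (T + 1) := by
    intro σ hσ s hs Q hQ
    have key : ∀ γ ∈ Γ, VanishesToOrder W (M.F P) (σ + s + γ) ((r + 1) * T + 1) := by
      rintro γ ⟨v, hv, τ, hτ, rfl⟩
      -- `s + v ∈ V₁ ⊆ X_{r+1}` and `σ + τ ∈ Σ(r+1)`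
      have hsv : s + v ∈ V₁ := by
        have h1 : s +ᵥ V₁ = V₁ := (mem_stab_iff).mp hs
        rw [← h1]; exact ⟨v, hv, rfl⟩
      have hX := hVsub hsv
      rw [M.mem_royX_iff hP] at hX
      have hmem : σ + τ ∈ sumset S (r + 1) := by
        have := add_mem_sumset_succ hτ hσ
        rwa [add_comm τ σ] at this
      have := hX (σ + τ) hmem
      rw [show s + v + (σ + τ) = σ + s + (v + τ) by abel] at this
      exact this
    have h := VanishesToOrder.of_mem_dIdeal M hP (Γ := Γ) (T := r * T) (K := (r + 1) * T + 1)
      (by rw [add_mul, one_mul]; omega) key hQ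
    rw [show (r + 1) * T + 1 - r * T = T + 1 by rw [add_mul, one_mul]; omega] at h
    exact h
  -- a point of `V₁`
  obtain ⟨v₀, hv₀⟩ := hV.nonempty
  refine ⟨St, hStcl, Γ, r, v₀, fun h hh => ?_, hSE, hH₀St, fun σ hσ => hcosE σ (hSE hσ), fun σ hσ => ?_,
    hdT, ?_, ?_⟩
  · -- `v₀ + h ∈ V₁ ⊆ X_{r+1} ⊆ X_0 = Z(P)`
    have hhSt : h +ᵥ V₁ = V₁ := (mem_stab_iff).mp (hH₀St hh)
    have hmem : v₀ + h ∈ V₁ := by rw [add_comm, ← hhSt]; exact ⟨v₀, hv₀, rfl⟩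
    have hX0 := M.royX_antitone hP h0 (Nat.zero_le (r + 1)) (hVsub hmem)
    rw [M.mem_royX_iff hP] at hX0
    have := hX0 0 (by rw [sumset_zero]; rfl)
    rwa [add_zero, zero_mul, zero_add, vanishesToOrder_one_iff] at this
  · exact le_antisymm (M.coneDim_mono (hcosE σ (hSE hσ))) (hdimE.trans (M.coneDim_vadd hc hH₀irr.isClosedG σ).symm.le)
  · -- `dim E ≤ dim H₀ ≤ dim St ≤ n` since `St ≠ V` (else `V₁ = V`, `X_0 = V`)
    have hStne : ((St : AddSubgroup V) : Set V) ≠ univ := by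
      intro huniv
      apply M.royX_zero_ne_univ (W := W) (S := S) (T := T) hP hP0
      refine eq_univ_of_forall fun g => M.royX_antitone hP h0 (Nat.zero_le (r + 1)) (hVsub ?_)
      have hg : g + -v₀ ∈ ((St : AddSubgroup V) : Set V) := huniv ▸ mem_univ _
      have hst : (g + -v₀) +ᵥ V₁ = V₁ := (mem_stab_iff).mp hg
      have : (g + -v₀) + v₀ ∈ V₁ := by rw [← hst]; exact ⟨v₀, hv₀, rfl⟩
      simpa using this
    have hlt := M.coneDim_lt_of_ssubset M.isIrred_univ hStcl ⟨0, St.zero_mem⟩ (ssubset_univ_iff.mpr hStne)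
    rw [M.coneDim_univ] at hlt
    have hH₀le : M.coneDim ((H₀ : AddSubgroup V) : Set V) ≤ M.coneDim ((St : AddSubgroup V) : Set V) :=
      M.coneDim_mono hH₀St
    -- `coneDim ≤ n` means `dim ≤ n - 1`; we only record `coneDim E ≤ n`
    change M.coneDim E ≤ n
    omega
  · refine le_antisymm hdimE ?_
    have : ((H₀ : AddSubgroup V) : Set V) ⊆ E := by
      have := hcosE 0 h0E
      rwa [zero_vadd] at this
    exact M.coneDim_mono this

end AnalyticGroupModel

end Literature.NumberTheory.Transcendental
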